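import Mathlib
import HarnessLib
import Summits.HubbardSuperconductivity.HubbardSuperconductivity.Theorems.KLProgrammeKLRegimeVolumeLimitHartreeLocal
import Summits.HubbardSuperconductivity.HubbardSuperconductivity.Theorems.KLProgrammeKLRegimeTwoPointAssemblyMatsubaraAllU
import Literature.MathematicalPhysics.QuantumLattice.HubbardFermiLiquidBoundProofs

/-!
# The `U`-linear (Hartree) term of the bare-frame VL carrier is EVENTUALLY BOUNDED BY `(5/2)|U|` — for EVERY coupling, uniformly in the
# volume `L ≥ 3` and in the frequency–momentum (seat hubbard-kl-k3c5-p2, g2)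

Route `KLProgramme`, gen-4 child 5 `KLRegimeVolumeLimitV12` (stmt-HubbardSuperconductivity-19858), `stub_vl_bound`; Step 2 of
HOME/hubbard-kl-k3c5-p2/TAU-BRIDGE.md §6 — COMPLETE.  By `hartree_term_eq_local` the `U`-linear term of `Σ̂⁰_{L,M}(k,σ̄)` (with its prefactor
`βL²/Z`) is `U · ∫ψ⁺_{(0,0)σ}ψ⁻_{(0,0)σ}e^{−V}/Z`; by t2's all-`U` equal-time identification
(`tendsto_grassmannTwoPoint_eq_hubbardThermalTwoPoint_sub_allU`) the normalised local insertion tends, as `M → ∞`, to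
`hubbardThermalTwoPoint β U (μ+U/2) L 0 0 σ σ − ½`, of norm `≤ 3/2` (`norm_hubbardThermalTwoPoint_le_one`).  Hence (`hartree_term_eventually_norm_le`)

  `∀ᶠ M, ‖(βL²/Z_M)·U(βL²)⁻³·∫dμ_{C_M} e^{−V}Σ_qψ̂⁺_{qσ}ψ̂⁻_{qσ}‖ ≤ (5/2)·|U|`   (every `L ≥ 3`, `β > 0`, real `U, μ`, spin `σ`),

a bound INDEPENDENT of `L`, of the frequency–momentum and of the frame — the first half of the registered `stub_vl_bound` on the direct
route.  The `U²` (current–current) term is Step 3.  Everything is proved; no definition.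
-/

noncomputable section

namespace Summit.HubbardSuperconductivity.HubbardSuperconductivity.Theorems.TwoPointAssembly

set_option linter.dupNamespace false -- summit = problem name (single-conjunct summit), D-0017

open Finset Filter Topology Literature.MathematicalPhysics.QuantumLattice Literature.Probability.LatticeModels GrassmannAlgebra
open Summit.HubbardSuperconductivity.HubbardSuperconductivity.Theorems.MatsubaraAllU

variable {L : ℕ} [NeZero L]

/-- **THE HARTREE TERM IS EVENTUALLY BOUNDED BY `(5/2)|U|`, EVERY COUPLING, UNIFORMLY IN `L ≥ 3` AND IN `k`.** -/
theorem hartree_term_eventually_norm_le (hL : 3 ≤ L) {β : ℝ} (hβ : 0 < β) (U μ : ℝ) (σ : Fin 2) :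
    ∀ᶠ M : ℕ in atTop,
      ‖((β * (L : ℝ) ^ 2 : ℝ) : ℂ) / effPartitionFn ℂ (hubbardCovarianceCT L M β μ 0 0) (hubbardInteraction L M β U) *
          ((U : ℂ) * (((1 / (β * (L : ℝ) ^ 2) ^ 3 : ℝ) : ℂ)) *
            gaussExpect ℂ (hubbardCovarianceCT L M β μ 0 0)
              (grassmannExp (-(hubbardInteraction L M β U)) * ∑ q : FreqMomentum L M, psiPlus q σ * psiMinus q σ))‖ ≤
        5 / 2 * |U| := by
  have hlim := tendsto_grassmannTwoPoint_eq_hubbardThermalTwoPoint_sub_allU hL hβ μ U σ σ (0 : Site 2) (0 : Site 2)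
  have hproj : Torus.proj L (0 : Site 2) = 0 := by funext i; simp [Torus.proj]
  rw [hproj] at hlim
  set g : ℂ := hubbardThermalTwoPoint β U (μ + U / 2) L 0 0 σ σ - (if σ = σ ∧ (0 : TorusSite 2 L) = 0 then (1 / 2 : ℂ) else 0) with hg
  have hgn : ‖g‖ ≤ 3 / 2 := by
    rw [hg, if_pos ⟨rfl, rfl⟩]
    calc ‖hubbardThermalTwoPoint β U (μ + U / 2) L 0 0 σ σ - (1 / 2 : ℂ)‖
        ≤ ‖hubbardThermalTwoPoint β U (μ + U / 2) L 0 0 σ σ‖ + ‖(1 / 2 : ℂ)‖ := norm_sub_le _ _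
      _ ≤ 1 + 1 / 2 := by
          gcongr
          · exact norm_hubbardThermalTwoPoint_le_one _ _ _ _ _ _ _ _
          · norm_num
      _ = 3 / 2 := by norm_num
  have hev := (Metric.tendsto_nhds.mp hlim) 1 one_pos
  filter_upwards [hev] with M hM
  rw [hartree_term_eq_local hβ U μ σ, ← hubbardCovarianceCT_zero_frame, norm_mul, Complex.norm_real, Real.norm_eq_abs, mul_comm]
  gcongr
  rw [hubbardCovarianceCT_zero_frame]
  rw [dist_eq_norm] at hM
  calc ‖_‖ ≤ ‖g‖ + ‖_ - g‖ := norm_le_insert' _ _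
    _ ≤ 3 / 2 + 1 := add_le_add hgn hM.le
    _ = 5 / 2 := by norm_num
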